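import Mathlib
import HarnessLib
import Summits.Ventures.LatticeQCDFlow.Scaling.TorusLines

/-!
# LatticeQCDFlow / Scaling — a vertex-isoperimetric inequality on the discrete torus `(ℤ/L)^d`:
# a set of intermediate density has `≥ c_d(δ)·L^{d-1}` boundary vertices

HONEST FRAMING: exact (Metropolis-corrected) sampling algorithms for lattice gauge theory;
figures of merit are autocorrelation/cost numbers at stated couplings and volumes; no
continuum-physics claim.

Venture `LatticeQCDFlow` (cell pub-lqcd), topic `Scaling`, FANOUT row 30 (lean-1) — OUR WORK, file 3
of the AUTOREGRESSIVE-CONTEXT (ELIMINATION-FRONT) VOLUME LAW.  For a vertex set `A` of the torus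
`(ℤ/L)^d` (`d ≥ 1`, `L ≥ 2`) with `δ·L^d ≤ |A| ≤ (1-δ)·L^d`, `0 < δ`, SOME axis `μ` has at least
`c_d(δ)·L^{d-1}` MIXED `μ`-lines (lines meeting both `A` and its complement), where
`c_1(δ) = 1`, `c_{d+1}(δ) = min(δ/2, c_d(δ/2)/d)` (`isoConst`); by `Scaling/TorusLines.lean` each
mixed line carries a vertex of the outer boundary, so **`|∂A| ≥ c_d(δ)·L^{d-1}`**
(`torus_card_outerBoundary_ge`).  PROOF (`exists_card_mixedLines_ge`, induction on the dimension,
slicing `(ℤ/L)^{d+1} = (ℤ/L) × (ℤ/L)^d` along the coordinate `0`): if some slice is SPARSE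
(`|A_h| < (δ/2)L^d`) then, a slice of density `≥ δ` existing by averaging, at least `(δ/2)L^d`
vertical lines are mixed; symmetrically if some slice is DENSE (`|A_h| > (1-δ/2)L^d`); otherwise
every slice has density in `[δ/2, 1-δ/2]`, the induction hypothesis gives each slice an axis with
`c_d(δ/2)·L^{d-1}` mixed lines inside the slice, one axis serves `≥ L/d` slices (pigeonhole), and
lines in distinct slices are distinct.  The constants are not optimised (`c_2(δ) = δ/2`,
`c_3(δ) = δ/8`, `c_4(δ) = δ/48`); only the ORDER `L^{d-1}` matters downstream.  Elementary; nothing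
is cited as a fact; `def isoConst`; no `sorry`.
-/

namespace Summit.Ventures.LatticeQCDFlow.Theory2.Autoregressive

open Finset Function
open Literature.Probability.LatticeModels (TorusSite torusGraph outerBoundary)

variable {L : ℕ}

/-! ## 1. The constants -/

/-- The isoperimetric constants `c_d(δ)`: `c_0 = c_1 = 1`, `c_{d+2}(δ) = min(δ/2, c_{d+1}(δ/2)/(d+1))`.
[folklore] -/
noncomputable def isoConst : ℕ → ℝ → ℝ
  | 0, _ => 1
  | 1, _ => 1
  | n + 2, δ => min (δ / 2) (isoConst (n + 1) (δ / 2) / (n + 1))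

/-- `c_d(δ) > 0` for `δ > 0`. [folklore] -/
theorem isoConst_pos : ∀ (n : ℕ) {δ : ℝ}, 0 < δ → 0 < isoConst n δ
  | 0, _, _ => by simp [isoConst]
  | 1, _, _ => by simp [isoConst]
  | n + 2, δ, hδ => by
    rw [isoConst]
    exact lt_min (by linarith) (div_pos (isoConst_pos (n + 1) (by linarith)) (by positivity))

/-- `c_{d+2}(δ) ≤ δ/2`. [folklore] -/
theorem isoConst_le_half (n : ℕ) (δ : ℝ) : isoConst (n + 2) δ ≤ δ / 2 := by
  rw [isoConst]; exact min_le_left _ _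

/-- `c_{d+2}(δ) ≤ c_{d+1}(δ/2)/(d+1)`. [folklore] -/
theorem isoConst_le_div (n : ℕ) (δ : ℝ) :
    isoConst (n + 2) δ ≤ isoConst (n + 1) (δ / 2) / (n + 1) := by
  rw [isoConst]; exact min_le_right _ _

/-! ## 2. Dimension one -/

/-- On the cycle `(ℤ/L)^1` a proper nonempty subset has a mixed line (the cycle itself).
[folklore] -/
theorem one_le_card_mixedLines_one [NeZero L] (A : Finset (TorusSite 1 L)) (h0 : A.Nonempty)
    (h1 : A ≠ univ) : 1 ≤ (mixedLines 0 A).card := by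
  obtain ⟨x, hx⟩ := h0
  obtain ⟨y, -, hy⟩ : ∃ y ∈ (univ : Finset (TorusSite 1 L)), y ∉ A := by
    by_contra h
    push Not at h
    exact h1 (eq_univ_iff_forall.mpr fun y => h y (mem_univ y))
  have hxy : update x 0 (y 0) = y := by
    funext i
    rw [Fin.fin_one_eq_zero i, update_self]
  exact one_le_card.mpr ⟨_, lineBase_mem_mixedLines hx (t := y 0) (hxy ▸ hy)⟩

/-! ## 3. The induction on the dimension -/

/-- Averaging over the `L` slices: if the slices have total size `≥ L·a` then some slice has size
`≥ a`. [folklore] -/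
theorem exists_slice_ge [NeZero L] {d : ℕ} (A : Finset (TorusSite (d + 1) L)) {a : ℝ}
    (h : (L : ℝ) * a ≤ A.card) : ∃ h₁ : ZMod L, a ≤ ((slice h₁ A).card : ℝ) := by
  have hsum : ∑ _h : ZMod L, a ≤ ∑ h : ZMod L, ((slice h A).card : ℝ) := by
    rw [sum_const, card_univ, ZMod.card, nsmul_eq_mul, ← Nat.cast_sum, sum_card_slice]
    exact h
  obtain ⟨h₁, -, hh₁⟩ := exists_le_of_sum_le univ_nonempty hsum
  exact ⟨h₁, hh₁⟩

/-- Averaging over the `L` slices: if the slices have total size `≤ L·a` then some slice has size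
`≤ a`. [folklore] -/
theorem exists_slice_le [NeZero L] {d : ℕ} (A : Finset (TorusSite (d + 1) L)) {a : ℝ}
    (h : (A.card : ℝ) ≤ (L : ℝ) * a) : ∃ h₁ : ZMod L, ((slice h₁ A).card : ℝ) ≤ a := by
  have hsum : ∑ h : ZMod L, ((slice h A).card : ℝ) ≤ ∑ _h : ZMod L, a := by
    rw [sum_const, card_univ, ZMod.card, nsmul_eq_mul, ← Nat.cast_sum, sum_card_slice]
    exact h
  obtain ⟨h₁, -, hh₁⟩ := exists_le_of_sum_le univ_nonempty hsum
  exact ⟨h₁, hh₁⟩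

/-- Two slices of different size give mixed vertical lines: `|A_{h₁}| - |A_{h₀}| ≤ #mixed_0(A)` in
`ℝ`. [folklore] -/
theorem card_slice_sub_le_mixedLines_real [NeZero L] {d : ℕ} (A : Finset (TorusSite (d + 1) L))
    (h₀ h₁ : ZMod L) :
    ((slice h₁ A).card : ℝ) - (slice h₀ A).card ≤ ((mixedLines 0 A).card : ℝ) := by
  have h := tsub_le_iff_right.mp (card_slice_sub_card_slice_le_mixedLines_zero A h₀ h₁)
  have h' : ((slice h₁ A).card : ℝ) ≤ (mixedLines 0 A).card + (slice h₀ A).card := by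
    exact_mod_cast h
  linarith

/-- **SOME AXIS HAS `≥ c_{d+1}(δ)·L^d` MIXED LINES** for every `A ⊆ (ℤ/L)^{d+1}` with
`δ L^{d+1} ≤ |A| ≤ (1-δ) L^{d+1}`, `δ > 0` — induction on `d` by slicing. [folklore] -/
theorem exists_card_mixedLines_ge : ∀ (d : ℕ) {L : ℕ} [NeZero L] {δ : ℝ}, 0 < δ →
    ∀ A : Finset (TorusSite (d + 1) L), δ * (L : ℝ) ^ (d + 1) ≤ A.card →
      (A.card : ℝ) ≤ (1 - δ) * (L : ℝ) ^ (d + 1) →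
      ∃ μ : Fin (d + 1), isoConst (d + 1) δ * (L : ℝ) ^ d ≤ ((mixedLines μ A).card : ℝ) := by
  intro d
  induction d with
  | zero =>
    intro L _ δ hδ A hlo hhi
    refine ⟨0, ?_⟩
    have hL : (0 : ℝ) < L := by exact_mod_cast Nat.pos_of_ne_zero (NeZero.ne L)
    have h0 : A.Nonempty := by
      rw [← card_pos, ← Nat.cast_pos (α := ℝ)]
      exact lt_of_lt_of_le (by positivity) hlo
    have h1 : A ≠ univ := by
      intro hA
      rw [hA, card_univ, Fintype.card_pi, Finset.prod_const, ZMod.card, card_univ,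
        Fintype.card_fin] at hhi
      push_cast at hhi
      nlinarith
    have := one_le_card_mixedLines_one A h0 h1
    simp only [isoConst, pow_zero, mul_one, Nat.one_le_cast]
    exact_mod_cast this
  | succ d ih =>
    intro L _ δ hδ A hlo hhi
    set V' : ℝ := (L : ℝ) ^ (d + 1) with hV'
    have hV'0 : 0 ≤ V' := by positivity
    have hpow : (L : ℝ) ^ (d + 2) = L * V' := by rw [hV', pow_succ']
    have htarget : ∀ μ : Fin (d + 2), δ / 2 * V' ≤ ((mixedLines μ A).card : ℝ) →
        ∃ μ : Fin (d + 2), isoConst (d + 2) δ * (L : ℝ) ^ (d + 1) ≤ ((mixedLines μ A).card : ℝ) :=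
      fun μ hμ => ⟨μ, (mul_le_mul_of_nonneg_right (isoConst_le_half d δ) hV'0).trans hμ⟩
    by_cases hlo' : ∃ h₀ : ZMod L, ((slice h₀ A).card : ℝ) < δ / 2 * V'
    · -- a sparse slice and a slice of density `≥ δ`
      obtain ⟨h₀, hh₀⟩ := hlo'
      obtain ⟨h₁, hh₁⟩ := exists_slice_ge A (a := δ * V') (by rw [hpow] at hlo; linarith)
      refine htarget 0 ?_
      have := card_slice_sub_le_mixedLines_real A h₀ h₁
      linarith
    by_cases hhi' : ∃ h₀ : ZMod L, (1 - δ / 2) * V' < ((slice h₀ A).card : ℝ)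
    · -- a dense slice and a slice of density `≤ 1 - δ`
      obtain ⟨h₀, hh₀⟩ := hhi'
      obtain ⟨h₁, hh₁⟩ := exists_slice_le A (a := (1 - δ) * V') (by rw [hpow] at hhi; linarith)
      refine htarget 0 ?_
      have := card_slice_sub_le_mixedLines_real A h₁ h₀
      linarith
    -- every slice has density in `[δ/2, 1 - δ/2]`: induction hypothesis in each slice
    push Not at hlo' hhi'
    have hih : ∀ h : ZMod L, ∃ μ : Fin (d + 1),
        isoConst (d + 1) (δ / 2) * (L : ℝ) ^ d ≤ ((mixedLines μ (slice h A)).card : ℝ) :=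
      fun h => ih (by linarith) (slice h A) (hlo' h) (by linarith [hhi' h])
    choose f hf using hih
    -- one axis serves `≥ L/(d+1)` slices
    obtain ⟨μ, -, hμ⟩ : ∃ μ ∈ (univ : Finset (Fin (d + 1))),
        (L : ℝ) / (d + 1) ≤ ((univ.filter fun h : ZMod L => f h = μ).card : ℝ) := by
      refine exists_le_of_sum_le univ_nonempty ?_
      rw [sum_const, card_univ, Fintype.card_fin, nsmul_eq_mul, ← Nat.cast_sum,
        ← card_eq_sum_card_fiberwise fun _ _ => mem_univ _, card_univ, ZMod.card]
      push_cast
      rw [mul_comm, div_mul_cancel₀ (L : ℝ) (by positivity : ((d : ℝ) + 1) ≠ 0)]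
    refine ⟨μ.succ, ?_⟩
    set S : Finset (ZMod L) := univ.filter fun h : ZMod L => f h = μ with hS
    have hc0 : 0 ≤ isoConst (d + 1) (δ / 2) * (L : ℝ) ^ d :=
      mul_nonneg (isoConst_pos (d + 1) (by linarith)).le (by positivity)
    calc isoConst (d + 2) δ * (L : ℝ) ^ (d + 1)
        ≤ isoConst (d + 1) (δ / 2) / (d + 1) * (L : ℝ) ^ (d + 1) :=
          mul_le_mul_of_nonneg_right (isoConst_le_div d δ) (by positivity)
      _ = (L : ℝ) / (d + 1) * (isoConst (d + 1) (δ / 2) * (L : ℝ) ^ d) := by ring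
      _ ≤ (S.card : ℝ) * (isoConst (d + 1) (δ / 2) * (L : ℝ) ^ d) :=
          mul_le_mul_of_nonneg_right hμ hc0
      _ = ∑ _h ∈ S, isoConst (d + 1) (δ / 2) * (L : ℝ) ^ d := by rw [sum_const, nsmul_eq_mul]
      _ ≤ ∑ h ∈ S, ((mixedLines μ (slice h A)).card : ℝ) := by
          refine sum_le_sum fun h hh => ?_
          have hfh : f h = μ := (mem_filter.mp hh).2
          exact hfh ▸ hf h
      _ ≤ ∑ h : ZMod L, ((mixedLines μ (slice h A)).card : ℝ) :=
          sum_le_sum_of_subset_of_nonneg (subset_univ S) fun _ _ _ => by positivity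
      _ ≤ ((mixedLines μ.succ A).card : ℝ) := by
          exact_mod_cast sum_card_mixedLines_slice_le A μ

/-! ## 4. The vertex-isoperimetric inequality -/

/-- **VERTEX ISOPERIMETRY ON THE TORUS `(ℤ/L)^d`** (`d ≥ 1`, `L ≥ 2`): a vertex set with
`δ L^d ≤ |A| ≤ (1-δ) L^d`, `δ > 0`, has at least `c_d(δ)·L^{d-1}` outer-boundary vertices in the
nearest-neighbour torus graph. [folklore] -/
theorem torus_card_outerBoundary_ge {d : ℕ} [NeZero L] (hL : 2 ≤ L) (hd : 1 ≤ d) {δ : ℝ}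
    (hδ : 0 < δ) (A : Finset (TorusSite d L)) (hlo : δ * (L : ℝ) ^ d ≤ A.card)
    (hhi : (A.card : ℝ) ≤ (1 - δ) * (L : ℝ) ^ d) :
    isoConst d δ * (L : ℝ) ^ (d - 1) ≤ ((outerBoundary (torusGraph d L) A).card : ℝ) := by
  obtain ⟨d, rfl⟩ : ∃ d', d = d' + 1 := ⟨d - 1, by omega⟩
  obtain ⟨μ, hμ⟩ := exists_card_mixedLines_ge d hδ A hlo hhi
  rw [Nat.add_sub_cancel]
  exact hμ.trans (by exact_mod_cast card_mixedLines_le_card_outerBoundary hL μ A)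

/-! ## 5. (GEN-16) The constants in closed form for `d ≤ 4` -/

/-- `c_2(δ) = δ/2` for `δ ≤ 2` (so for every density `δ ≤ 1`). [ours] -/
theorem isoConst_two {δ : ℝ} (hδ : δ ≤ 2) : isoConst 2 δ = δ / 2 := by
  have h : isoConst (0 + 2) δ = min (δ / 2) (isoConst (0 + 1) (δ / 2) / (0 + 1)) := by
    rw [isoConst.eq_3]; norm_num
  have h1 : isoConst (0 + 1) (δ / 2) = 1 := isoConst.eq_2 (δ / 2)
  rw [h1] at h
  norm_num at h
  rw [h]
  exact min_eq_left (by linarith)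

/-- `c_3(δ) = δ/8` for `0 ≤ δ ≤ 4`. [ours] -/
theorem isoConst_three {δ : ℝ} (h0 : 0 ≤ δ) (hδ : δ ≤ 4) : isoConst 3 δ = δ / 8 := by
  have h : isoConst (1 + 2) δ = min (δ / 2) (isoConst 2 (δ / 2) / (1 + 1)) := by
    rw [isoConst]; norm_num
  rw [show (3 : ℕ) = 1 + 2 from rfl, h, isoConst_two (by linarith)]
  rw [min_eq_right (by linarith)]
  ring

/-- `c_4(δ) = δ/48` for `0 ≤ δ ≤ 8`. [ours] -/
theorem isoConst_four {δ : ℝ} (h0 : 0 ≤ δ) (hδ : δ ≤ 8) : isoConst 4 δ = δ / 48 := by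
  have h : isoConst (2 + 2) δ = min (δ / 2) (isoConst 3 (δ / 2) / (2 + 1)) := by
    rw [isoConst]; norm_num
  rw [show (4 : ℕ) = 2 + 2 from rfl, h, isoConst_three (by linarith) (by linarith)]
  rw [min_eq_right (by linarith)]
  ring

/-- The constants of the elimination-front law `c_d = c_d(1/(8d))` (`Scaling/EliminationFrontTorus`)
in closed form: `c_2 = 1/32`, `c_3 = 1/192`, `c_4 = 1/1536`. [ours] -/
theorem isoConst_eliminationFront_values :
    isoConst 2 (1 / (8 * 2)) = 1 / 32 ∧ isoConst 3 (1 / (8 * 3)) = 1 / 192 ∧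
      isoConst 4 (1 / (8 * 4)) = 1 / 1536 := by
  refine ⟨?_, ?_, ?_⟩
  · rw [isoConst_two (by norm_num)]; norm_num
  · rw [isoConst_three (by norm_num) (by norm_num)]; norm_num
  · rw [isoConst_four (by norm_num) (by norm_num)]; norm_num

/-- `c_d(δ) ≤ 1` for `d ≥ 2` and `δ ≤ 2`: the boundary count `c_d(δ)·L^{d-1}` never exceeds one
hyperplane's worth of vertices. [ours] -/
theorem isoConst_le_one (n : ℕ) {δ : ℝ} (hδ : δ ≤ 2) : isoConst (n + 2) δ ≤ 1 :=
  (isoConst_le_half n δ).trans (by linarith)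

end Summit.Ventures.LatticeQCDFlow.Theory2.Autoregressive
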